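import Mathlib

/-!
# SoloInformed — dust label combinatorics (CONSTRUCTION C, `paper/CAPS.md` §9.2)

Kernel for the elementary heart of ERRATUM 2 of the soloist's cap analysis
(`run/shared/lean/ideation/FinalStateConjecture/solo-informed/paper/CAPS.md` §9):
with dyadic label windows `dustWindow τ₀ m j = (τ₀ + (j-1)/2^m, τ₀ + (j+1)/2^m)`,

* every label `τ₁ ≥ τ₀` lies in `dustWindow τ₀ m j` for some `j`, for EVERY generation `m`
  (`exists_mem_dustWindow`), so under any pairing `k (m, j) ≥ m` it is carried by pieces of
  arbitrarily large index (`exists_piece_index_ge`, with Mathlib's `Nat.pair`);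
* membership `τ ∈ dustWindow τ₀ m j` forces `(τ - τ₀) * 2^m - 1 < j`, hence `τ - τ₀ - 1 < j`
  (`sub_lt_of_mem_dustWindow`), so under any pairing `k (m, j) ≥ j` large labels are carried
  only by pieces of large index (`index_gt_of_mem`) — which is what makes the dust's
  C²-deviation tend to zero along labels while every label's certified slab stays cofinal;
* the spatial centres `1 - 2^{-k}` with radii `2^{-(k+3)}` are separated (`dust_centres_separated`),
  so the pieces are pairwise disjoint.

No geometry is formalised here; these are the order/arithmetic facts the construction rests on.
-/

namespace Summit.FinalStateConjecture.FinalStateConjecture.Theorems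

open Set

/-- The dyadic label window of generation `m` and position `j` above `τ₀`. -/
def dustWindow (τ₀ : ℝ) (m j : ℕ) : Set ℝ :=
  Ioo (τ₀ + ((j : ℝ) - 1) / 2 ^ m) (τ₀ + ((j : ℝ) + 1) / 2 ^ m)

/-- The explicit position `⌊(τ₁ - τ₀)·2^m⌋₊` of generation `m` carries the label `τ₁ ≥ τ₀`. -/
theorem mem_dustWindow_floor {τ₀ τ₁ : ℝ} (h : τ₀ ≤ τ₁) (m : ℕ) :
    τ₁ ∈ dustWindow τ₀ m ⌊(τ₁ - τ₀) * 2 ^ m⌋₊ := by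
  have hpow : (0 : ℝ) < 2 ^ m := by positivity
  set x : ℝ := (τ₁ - τ₀) * 2 ^ m with hx
  have hx0 : 0 ≤ x := mul_nonneg (sub_nonneg.mpr h) hpow.le
  have h1 : (⌊x⌋₊ : ℝ) ≤ x := Nat.floor_le hx0
  have h2 : x < (⌊x⌋₊ : ℝ) + 1 := Nat.lt_floor_add_one x
  refine ⟨?_, ?_⟩
  · have : ((⌊x⌋₊ : ℝ) - 1) / 2 ^ m < τ₁ - τ₀ := by
      rw [div_lt_iff₀ hpow]; linarith
    linarith
  · have : τ₁ - τ₀ < ((⌊x⌋₊ : ℝ) + 1) / 2 ^ m := by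
      rw [lt_div_iff₀ hpow]; linarith
    linarith

/-- Every label `τ₁ ≥ τ₀` is carried at EVERY generation `m`. -/
theorem exists_mem_dustWindow {τ₀ τ₁ : ℝ} (h : τ₀ ≤ τ₁) (m : ℕ) :
    ∃ j : ℕ, τ₁ ∈ dustWindow τ₀ m j :=
  ⟨_, mem_dustWindow_floor h m⟩

/-- Membership in a window bounds the position index from below by the rescaled label. -/
theorem lt_of_mem_dustWindow {τ₀ τ : ℝ} {m j : ℕ} (h : τ ∈ dustWindow τ₀ m j) :
    (τ - τ₀) * 2 ^ m - 1 < j := by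
  have hpow : (0 : ℝ) < 2 ^ m := by positivity
  have h2 : τ - τ₀ < ((j : ℝ) + 1) / 2 ^ m := by
    have := h.2; linarith
  rw [lt_div_iff₀ hpow] at h2
  linarith

/-- Membership in a window bounds the position index from below by the label itself. -/
theorem sub_lt_of_mem_dustWindow {τ₀ τ : ℝ} {m j : ℕ} (hτ : τ₀ ≤ τ)
    (h : τ ∈ dustWindow τ₀ m j) : τ - τ₀ - 1 < j := by
  have hpow : (1 : ℝ) ≤ 2 ^ m := one_le_pow₀ (by norm_num)
  have h1 := lt_of_mem_dustWindow h
  have hnn : 0 ≤ τ - τ₀ := sub_nonneg.mpr hτ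
  nlinarith

/-- For every label `τ₁ ≥ τ₀` and every bound `K` some piece of index `≥ K` carries `τ₁`
(index = Mathlib's `Nat.pair` of generation and position). -/
theorem exists_piece_index_ge {τ₀ τ₁ : ℝ} (h : τ₀ ≤ τ₁) (K : ℕ) :
    ∃ m j : ℕ, K ≤ Nat.pair m j ∧ τ₁ ∈ dustWindow τ₀ m j := by
  obtain ⟨j, hj⟩ := exists_mem_dustWindow h K
  exact ⟨K, j, Nat.left_le_pair K j, hj⟩

/-- Every piece carrying a label `τ ≥ τ₀` has index `> τ - τ₀ - 1`. -/
theorem index_gt_of_mem {τ₀ τ : ℝ} {m j : ℕ} (hτ : τ₀ ≤ τ) (h : τ ∈ dustWindow τ₀ m j) :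
    τ - τ₀ - 1 < (Nat.pair m j : ℝ) := by
  have h1 := sub_lt_of_mem_dustWindow hτ h
  have h2 : (j : ℝ) ≤ (Nat.pair m j : ℝ) := by exact_mod_cast Nat.right_le_pair m j
  linarith

/-- The spatial centres `1 - 2^{-k}` with radii `2^{-(k+3)}` are separated: for `k < l` the
`k`-th interval ends before the `l`-th begins. -/
theorem dust_centres_separated {k l : ℕ} (h : k < l) :
    (1 - (2 : ℝ)⁻¹ ^ k) + (2 : ℝ)⁻¹ ^ (k + 3) < (1 - (2 : ℝ)⁻¹ ^ l) - (2 : ℝ)⁻¹ ^ (l + 3) := by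
  have h0 : (0 : ℝ) ≤ 2⁻¹ := by norm_num
  have h1 : (2 : ℝ)⁻¹ ≤ 1 := by norm_num
  have hu : (0 : ℝ) < 2⁻¹ ^ k := by positivity
  have hv : (2 : ℝ)⁻¹ ^ l ≤ 2⁻¹ ^ (k + 1) := pow_le_pow_of_le_one h0 h1 (by omega)
  have e1 : (2 : ℝ)⁻¹ ^ (k + 3) = 2⁻¹ ^ k * 8⁻¹ := by rw [pow_add]; norm_num
  have e2 : (2 : ℝ)⁻¹ ^ (l + 3) = 2⁻¹ ^ l * 8⁻¹ := by rw [pow_add]; norm_num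
  have e3 : (2 : ℝ)⁻¹ ^ (k + 1) = 2⁻¹ ^ k * 2⁻¹ := by rw [pow_succ]
  rw [e1, e2]; rw [e3] at hv
  have hv0 : (0 : ℝ) < 2⁻¹ ^ l := by positivity
  nlinarith

end Summit.FinalStateConjecture.FinalStateConjecture.Theorems
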